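import Summits.AtomisticToContinuum.BoseEinsteinCondensation.Theses.BECFisherTransfer

/-!
# Route `BECFisherTransfer`, assembly item `Assembly` (stmt-AtomisticToContinuum-14307)

Settles the assembly item `stmt-AtomisticToContinuum-14307` of route
`route-AtomisticToContinuum-BECFisherTransfer`: the implication

  `HealingScaleCoherence → CoherencePropagation → BoundaryTransferWeak → BoseEinsteinCondensation`

(the audited sub-problem abbrev `_root_.BoseEinsteinCondensation`, by name).

The hypotheses of `Assembly` are, verbatim and in the same order, those of the route's deciding
theorem `closes`, and the proof is the same bookkeeping, spelled out here so that this file depends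
only on the item statements: fix an admissible `v`; `HealingScaleCoherence` gives an exponent
`σ > 0`, a density threshold `ρ₂` and, for `ρ < ρ₂`, eventually in `N` a slack `δ₂` below which every
near-minimiser of the periodic energy is `¾`-coherent out to `a (ρ a³)^(-1/2-σ)`;
`CoherencePropagation` at that `σ` gives `ρ₁` and eventually a slack `δ₁` below which `¾`-coherence
forces `condensateOccupation ≥ N/2`.  For `ρ < min ρ₁ ρ₂`, with `c := 1/2` and `δ := min δ₁ δ₂`
(eventually in `N`), every `δ`-near-minimiser therefore has `condensateOccupation ≥ (1/2)·N`, which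
is the periodic-BEC hypothesis of `BoundaryTransferWeak v`; its conclusion
`∃ ρ₀ > 0, ∀ ρ ∈ (0, ρ₀), HasGroundStateBEC v ρ` is the body of the conjunct.
Pure logic; no analytic content lives here.

References: [LSSY2005, §1.2 and Ch. 5] (the conjunct being assembled; periodic vs Dirichlet
boundary conditions, Ch. 2), [PenroseOnsager1956] (the one-mode occupation criterion).
-/

namespace Summit.AtomisticToContinuum.BoseEinsteinCondensation.Theorems

/-- **Item stmt-AtomisticToContinuum-14307** (`Assembly` of route `BECFisherTransfer`, exact route
decl): `HealingScaleCoherence → CoherencePropagation → BoundaryTransferWeak →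
BoseEinsteinCondensation`.  Given `hLoc`, `hProp`, `hBC` and an admissible `v`, apply `hBC v` and
produce its periodic-BEC hypothesis with the explicit constant `c = 1/2`: take the exponent `σ` and
threshold `ρ₂` of `hLoc v`, the threshold `ρ₁` of `hProp v σ`, work below `min ρ₁ ρ₂`, and
eventually in `N` use the slack `min δ₁ δ₂` of the two eventual slacks, so that every
near-minimiser is `¾`-coherent (by `hLoc`) hence half-condensed (by `hProp`).  Pure composition of
the route's hypotheses (the route's deciding theorem `closes`, re-proved inline). [folklore] -/
theorem becFisherTransfer_assembly_proof :
    Summit.AtomisticToContinuum.BoseEinsteinCondensation.Theses.BECFisherTransfer.Assembly := by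
  unfold Theses.BECFisherTransfer.Assembly
  intro hLoc hProp hBC v hv
  refine hBC v hv ?_
  obtain ⟨σ, hσ, ρ₂, hρ₂, hA'⟩ := hLoc v hv
  obtain ⟨ρ₁, hρ₁, hP'⟩ := hProp v hv σ hσ
  refine ⟨min ρ₁ ρ₂, lt_min hρ₁ hρ₂, fun ρ hρ hρlt => ?_⟩
  have h₁ := hP' ρ hρ (lt_of_lt_of_le hρlt (min_le_left _ _))
  have h₂ := hA' ρ hρ (lt_of_lt_of_le hρlt (min_le_right _ _))
  refine ⟨1 / 2, by norm_num, ?_⟩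
  filter_upwards [h₁, h₂] with N hN₁ hN₂
  obtain ⟨δ₁, hδ₁, H₁⟩ := hN₁
  obtain ⟨δ₂, hδ₂, H₂⟩ := hN₂
  refine ⟨min δ₁ δ₂, lt_min hδ₁ hδ₂, fun Ψ hΨ => ?_⟩
  exact H₁ Ψ (hΨ.trans <| by gcongr; exact min_le_left _ _)
    (H₂ Ψ (hΨ.trans <| by gcongr; exact min_le_right _ _))

end Summit.AtomisticToContinuum.BoseEinsteinCondensation.Theorems
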